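/-
Copyright (c) 2026 the pub-hodgecm-mathlib formalisation cell (harness21).  Prover seats hodgecm-mathlib-F0P3a-p03 (g17) (ED. 1 ★) and F0P3a-p07 (g14) (this ED. 2): «S3-ram» seeding wave (LEAD F0P3a-plan
(g12) T11-79∕T11-80∕T11-88; owner F0P3a-p06 (g15)), (α₂) A₂ (d) ledger v1.3 of F0P3a-p07 (g13), row «`stub_T2G_asm`» (even discriminant depth), μ-FREE count socket; 2026-09-02.
-/
import Literature.NumberTheory.Rogawski1990.UnitFundamentalLemmaNonsplitTwoClassesAssembly   -- ★ p847309 (this seat): the two-classes assembly `exists_signedPair_…_of_frame`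
import Literature.NumberTheory.Automorphic.UnitaryLevelOnePieceOrbitalIntegralRamified       -- ★ p847154 (F0P3a-p05): the six-strata conversion `classOrbitalIntegral_eq_mul_sixStrata_of_vDeep_ramified`
import Literature.NumberTheory.Automorphic.UnitaryTypeTwoNormPairCentralizerCompactRamified   -- ★ p846839 (A-p12): compact centralisers of type-(2) matches at any non-split place
import Literature.NumberTheory.Rogawski1990.FinExplicitTransferFactorConjLeft                 -- ★ `finExplicitDelta_conj_left_all`
import Literature.NumberTheory.Rogawski1990.FinExplicitTransferFactorConjRight                -- ★ `finExplicitDelta_conj_right_all`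
import Literature.NumberTheory.Rogawski1990.LocalTransferLinear                               -- ★ `isRegularElt_of_isLocalNormPair`
import Literature.NumberTheory.Rogawski1990.DepthZeroKappaTransferTypeTwoGSide                  -- ★ `setOf_entrywise_deep_mem_nhds_one` (the tube is a neighbourhood of 1)
import Literature.NumberTheory.Rogawski1990.DepthZeroKappaTransferRamifiedTokensScalar           -- ★ p847488 (F0P3a-p07 (g14)): tokens near 1 + the scalar `τ·D = (β,θ)_v·q^{−m}` on a μ-dependent neighbourhood
import HarnessLib

/-!
# The type-(2) G-side row at Even discriminant depth, ∃V-SHAPED (A-p12 (g24) skeleton v0.6 socket :78 `stub_typeTwo_GSide_even_ram` (= `hGe`′ of ROW ED. 2), ASSEMBLED from the two-classes layer, the six-strata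
# conversion and two named sockets: (Lit2) v-deep representatives of both matched classes, (Cnt2′) the five signed strata count laws, μ-FREE — ED. 2 of ★ p847470∕p847471
# (Rogawski 1990 Prop. 4.9.1 (a))

Topic `NumberTheory/Rogawski1990`; namespace `Literature.NumberTheory.Rogawski1990`.  THEOREMS ONLY (no definition, no named fact, no instance, no notation, no `sorry`); kernel lane
`--supports stmt-HodgeConjecture-24833`.  Cell `pub/hodgecm-mathlib`, crux H413; «S3-ram» seeding wave (Literature seeding, count-neutral), the tame-ramified fold v7.2 (3c375ed6,
architect A-p12 (g24) FINDING 00:31:31Z + LEAD F0P3a-plan (g12) T11-84 + ref5 (g5) R-324∕R-325: the γH-keyed sockets :293∕:366 of fold v7.2 (= `hGe`∕`hGo` of ★ p847306) are MISSTATED and are RE-FILED ∃V-SHAPED (skeleton v0.6 8f7998252aec1790 :78 `stub_typeTwo_GSide_even_ram` ∕ :151 `stub_typeTwo_GSide_odd_ram`, texts «=» R-325) — THIS FILE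
DISCHARGES the even one: binders VERBATIM (five unused ones `_`-prefixed) and conclusion = the v0.6 socket text VERBATIM (`∃ V ∈ 𝓝 1, ∀ γH ∈ V, regular → rootless → ∀ n, <disc token> → 1 ≤ n → Σᶠ Δ‴·Φ = …`),
proved here OVER TWO HYPOTHESIS-SOCKETS in the re-skeleton of F0P3a-p07 (g13)'s ASSEMBLY LEDGER v1.3 §2 (row `stub_T2G_asm` = this file; rows `stub_T2G_{bd,reg,zero,pm}` = the count
laws feeding (Cnt2)):
* **(Lit2)** `hLit` — for every type-(2) `γ_H` in the 2-DEEP TUBE (block `γ_W ≡ 1` AND `u ≡ 1 (mod ϖ_w²)` — ref5 R-324 (a): both lines must read `ϖ_w²`) of the given depth `n ≥ 1`: two elements `t₊, t₋ ∈ G′_v` matched with `γ_H`, of signs `κ_v = 1, −1`, BOTH v-DEEP (`t_w ≡ 1 (mod ϖ_v)`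
  entrywise) — the «TYPE-(2) LITERALS» (type-(2) twin of ★ `exists_four_ramified_representatives`; the second class is NOT a similitude-conjugate of the first in odd rank, so a second
  literal is genuinely needed; for a deep class v-deep representatives exist since the eigenvalue depth is `≥ 2`);
* **(Cnt2′)** `hCnt` — the five SIGNED STRATA COUNT LAWS, μ-FREE (ED. 2; LEAD T11-88, ref5 R-330): for every depth token `m` (`|χ_g(u)_w| = |ι_w ϖ_v|^m`) and every
  symmetrised discriminant `β ∈ (L⁺_v)ˣ` of `γ_H`, `(β, θ)_v·q^{−m}·(n_j(t₊) − n_j(t₋)) = (y_λ, θ)_v · X̃_j(n)` [ED. 1 carried `τ_v(γ_H, μ)·D_v(γ_H)` here, which depends on the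
  conductor of `μ_w` and is therefore not determined on the explicit tube — F0P3a-p07 (g14) finding 2026-09-02T00:53Z; the scalar is now evaluated INSIDE this file on a
  μ-dependent neighbourhood, ★ p847488 `exists_nhds_one_forall_tokens_finTau_mul_finWeylRatio_eq`, exactly as the type-(1) ★ design ★ p847337∕p847437 does] (`j = bd, reg, 1□, 1ε, 0`; counts = the `ncard` sets of ★
  `classOrbitalIntegral_eq_mul_sixStrata_of_vDeep_ramified` VERBATIM; profiles `X̃` = the socket's closed forms; CERT P2ram 09bbc9d7 items 2∕5, ledger v1.3 laws (S-bd)(S-reg)(S-0)(S-1±)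
  with the dictionary `τ·D = (β,θ)_v·q^{−V}`, `(β,θ)_v·κ(t₀) = (y_λ,θ)_v`).
PROOF.  `V :=` the 2-deep tube in both coordinates (★ `setOf_entrywise_deep_mem_nhds_one` at `c := ϖ_w²`) ∩ the μ-dependent neighbourhood `VS` of ★ p847488 (tokens `m, β` and
`τ·D = (β, θ)_v·q^{−m}` on matched `t` with `κ = ±1`).  Per `γ_H ∈ V`: the two classes and their exhaustion (★ `exists_signedPair_finsum_delta_mul_classOrbitalIntegral_eq_mul_sub_of_frame`) give `Σᶠ Δ‴·Φ = τ·D·(Φ(⟦t₊⟧, g) − Φ(⟦t₋⟧, g))`;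
the six-strata conversion at `t_±` (regular: ★ `isRegularElt_of_isLocalNormPair`; compact centraliser: ★ `compactSpace_centralizer_of_isLocalNormPair_of_not_exists_isRoot_nonsplit`;
v-deep: (Lit2); the fold's five strata values `(c₂, c′0, c′2, c₁s, c₁n)` repackaged as the conversion's `(c, c′, c₁, ε)` with `c₁ t = if IsSquare t then c₁s else c₁n` and a residue
non-square `ε`, ★ `FiniteField.exists_nonsquare`) gives `Φ(⟦t_±⟧, g) = ν_G(K′)·Σ_j c_j n_j(t_±)`; then (Cnt2) and `linear_combination`.
HONEST LABEL: HC_CM is proved only modulo the 2 remaining named inputs (hLiu418 24832, h413 24833) until rung 0 closes; this file is bookkeeping over ★ organs plus two named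
hypothesis-sockets, no books consequence.

## References
* [Rogawski1990] J. D. Rogawski, *Automorphic Representations of Unitary Groups in Three Variables*, Ann. of Math. Stud. 123 (1990), §4.9 Prop. 4.9.1 (a)(b) pp. 54–56, §4.3
  (4.3.1)–(4.3.2) p. 43.  [Flicker1998UnitaryFL] Y. Z. Flicker, *Elementary proof of the fundamental lemma for a unitary group*, Canad. J. Math. 50 (1998), §6 Thm. 18 p. 97.
  [Kottwitz1986] R. E. Kottwitz, *Base change for unit elements of Hecke algebras*, Compositio Math. 60 (1986), §3.  [Laumon1995] G. Laumon, *Cohomology of Drinfeld Modular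
  Varieties* I (1996), Lemma (5.3.2) (orbital integrals as weighted fixed-point counts).
-/

set_option autoImplicit false

noncomputable section

open MeasureTheory Measure Set Filter Topology NumberField IsDedekindDomain Matrix Polynomial ValuativeRel
open Literature.NumberTheory.Automorphic Literature.NumberTheory.Automorphic.UnitaryGroup
open Literature.NumberTheory.Automorphic.IntegralReduction Literature.NumberTheory.GaloisRepresentations
open Literature.NumberTheory.NumberFields Literature.NumberTheory.QuadraticForms
open Literature.GroupTheory.SpecificGroups Literature.NumberTheory.Automorphic.UnitaryLatticeTree
open scoped Matrix MatrixGroups ValuativeRel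

namespace Literature.NumberTheory.Rogawski1990

/-- In a field, `IsSquare (a² t) ↔ IsSquare t` for `a ≠ 0`. [folklore] -/
private theorem isSquare_sq_mul_iff_even₂ {k : Type*} [Field k] {a : k} (ha : a ≠ 0) (t : k) : IsSquare (a ^ 2 * t) ↔ IsSquare t := by
  refine ⟨fun ⟨r, hr⟩ => ⟨a⁻¹ * r, ?_⟩, fun ⟨r, hr⟩ => ⟨a * r, by rw [hr]; ring⟩⟩
  have : t = a⁻¹ ^ 2 * (a ^ 2 * t) := by field_simp
  rw [this, hr]; ring

set_option maxHeartbeats 3200000 in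
-- the ≈ 70-binder socket text + two long hypothesis-sockets + two instantiations of the ★ six-strata conversion
/-- **THE TYPE-(2) G-SIDE ROW AT Even DEPTH, ∃V-SHAPED, ASSEMBLED — ED. 2, μ-FREE COUNT SOCKET (Cnt2′)** — A-p12 (g24) skeleton v0.6 socket :78 `stub_typeTwo_GSide_even_ram` (= `hGe`′ of ROW ED. 2 `typeTwoRow_ram_of_typeTwoGSideNhds_of_massRatio`): binders VERBATIM, conclusion = the socket text VERBATIM, over the two hypothesis-sockets (Lit2) `hLit` and (Cnt2) `hCnt` keyed on the 2-deep tube; `V :=` that tube (module docstring)); everything else ★.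
[cite: Rogawski1990, §4.9 Prop. 4.9.1 (a) p. 55; §4.3 (4.3.1)–(4.3.2) p. 43] [cite: Flicker1998UnitaryFL, §6 Thm. 18 p. 97] [cite: Laumon1995, Lemma (5.3.2)] -/
theorem typeTwo_GSideNhds_even_ram_of_literals_of_counts
    (L : Type) [Field L] [NumberField L] [IsCMField L] (H' : Matrix (Fin 3) (Fin 3) L) (μ : HeckeCharacter L)
    {v : HeightOneSpectrum (𝓞 ↥(maximalRealSubfield L))}
    (hH' : (H'.map (cmConjRingHom L)).transpose = H') (w : PlacesOver L v)
    (hw : IsCMField.complexConj L • w.1 = w.1) (he : v.asIdeal.ramificationIdx' w.1.asIdeal ≠ 1)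
    (hH'w : IsUnit (placeForm H' w.1)) (hH'i : hH'w.unit ∈ glInt 3 (w.1.adicCompletion L))
    (_hμu : μ.IsUnitary)
    (hμω : ∀ x : ideleGroup ↥(maximalRealSubfield L), μ (AdeleRing.ideleBaseChange ↥(maximalRealSubfield L) L x) = quadraticHeckeCharCM L x)
    (h2 : IsUnit (2 : 𝒪[w.1.adicCompletion L]))
    -- the ramified block (R) and the integral antidiagonal frame of `H′_w` (★ `ramifiedBlock_adicCompletion`, ★ p846344) — SUPPLIED by the contract, BINDERS for the sockets
    (ϖ : w.1.adicCompletion L) (hϖ : Valued.v ϖ = WithZero.exp (-1 : ℤ)) (hσϖ : galAdicCompletionMap (L := L) (IsCMField.complexConj L) hw ϖ = -ϖ)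
    (A : GL (Fin 3) (w.1.adicCompletion L)) (hA : A ∈ glInt 3 (w.1.adicCompletion L))
    (hframe : placeForm H' w.1 = (-(placeForm H' w.1).det) • formCongr (galAdicCompletionMap (L := L) (IsCMField.complexConj L) hw) A ((StdForm.antidiagonal 3).over (w.1.adicCompletion L)))
    [MeasurableSpace ((cmDatum L 3 H').Local v)] [BorelSpace ((cmDatum L 3 H').Local v)]
    [∀ γ : ((cmDatum L 3 H').Local v), MeasurableSpace (((cmDatum L 3 H').Local v) ⧸ Subgroup.centralizer ({γ} : Set ((cmDatum L 3 H').Local v)))]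
    [∀ γ : ((cmDatum L 3 H').Local v), BorelSpace (((cmDatum L 3 H').Local v) ⧸ Subgroup.centralizer ({γ} : Set ((cmDatum L 3 H').Local v)))]
    [MeasurableSpace ((cmDatum L 2 (Matrix.of fun i j : Fin 2 => if i.val + j.val + 1 = 2 then (1 : L) else 0)).Local v × (cmDatum L 1 (Matrix.of fun i j : Fin 1 => if i.val + j.val + 1 = 1 then (1 : L) else 0)).Local v)] [BorelSpace ((cmDatum L 2 (Matrix.of fun i j : Fin 2 => if i.val + j.val + 1 = 2 then (1 : L) else 0)).Local v × (cmDatum L 1 (Matrix.of fun i j : Fin 1 => if i.val + j.val + 1 = 1 then (1 : L) else 0)).Local v)]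
  [∀ a : (cmDatum L 2 (Matrix.of fun i j : Fin 2 => if i.val + j.val + 1 = 2 then (1 : L) else 0)).Local v × (cmDatum L 1 (Matrix.of fun i j : Fin 1 => if i.val + j.val + 1 = 1 then (1 : L) else 0)).Local v, MeasurableSpace (((cmDatum L 2 (Matrix.of fun i j : Fin 2 => if i.val + j.val + 1 = 2 then (1 : L) else 0)).Local v × (cmDatum L 1 (Matrix.of fun i j : Fin 1 => if i.val + j.val + 1 = 1 then (1 : L) else 0)).Local v) ⧸ Subgroup.centralizer ({a} : Set ((cmDatum L 2 (Matrix.of fun i j : Fin 2 => if i.val + j.val + 1 = 2 then (1 : L) else 0)).Local v × (cmDatum L 1 (Matrix.of fun i j : Fin 1 => if i.val + j.val + 1 = 1 then (1 : L) else 0)).Local v)))]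
  [∀ a : (cmDatum L 2 (Matrix.of fun i j : Fin 2 => if i.val + j.val + 1 = 2 then (1 : L) else 0)).Local v × (cmDatum L 1 (Matrix.of fun i j : Fin 1 => if i.val + j.val + 1 = 1 then (1 : L) else 0)).Local v, BorelSpace (((cmDatum L 2 (Matrix.of fun i j : Fin 2 => if i.val + j.val + 1 = 2 then (1 : L) else 0)).Local v × (cmDatum L 1 (Matrix.of fun i j : Fin 1 => if i.val + j.val + 1 = 1 then (1 : L) else 0)).Local v) ⧸ Subgroup.centralizer ({a} : Set ((cmDatum L 2 (Matrix.of fun i j : Fin 2 => if i.val + j.val + 1 = 2 then (1 : L) else 0)).Local v × (cmDatum L 1 (Matrix.of fun i j : Fin 1 => if i.val + j.val + 1 = 1 then (1 : L) else 0)).Local v)))]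
    (νH : Measure ((cmDatum L 2 (Matrix.of fun i j : Fin 2 => if i.val + j.val + 1 = 2 then (1 : L) else 0)).Local v × (cmDatum L 1 (Matrix.of fun i j : Fin 1 => if i.val + j.val + 1 = 1 then (1 : L) else 0)).Local v)) [νH.IsHaarMeasure] [νH.IsMulRightInvariant]
    (νG : Measure ((cmDatum L 3 H').Local v)) [νG.IsHaarMeasure] [νG.IsMulRightInvariant]
    {mH : OrbitalMeasureFamily ((cmDatum L 2 (Matrix.of fun i j : Fin 2 => if i.val + j.val + 1 = 2 then (1 : L) else 0)).Local v × (cmDatum L 1 (Matrix.of fun i j : Fin 1 => if i.val + j.val + 1 = 1 then (1 : L) else 0)).Local v)} {mG : OrbitalMeasureFamily ((cmDatum L 3 H').Local v)}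
    (_hmH : mH.IsCanonical (IsLocalGRegular L v) νH)
    (hmG : mG.IsCanonical (fun γ => IsRegularElt (γ.val : GL (Fin 3) (UnitaryGroup.LocalRing L v))) νG)
    -- the piece: `C_c^∞`, supported in the hyperspecial `K`, `Ad K`-invariant, left-invariant under the level-2 congruence set (A-69 (β), `j = 2`)
    (g : ((cmDatum L 3 H').Local v) → ℂ) (hg : IsLocSmooth g) (hgK : tsupport g ⊆ (cmLocalIntegralLevel L 3 H' v : Set ((cmDatum L 3 H').Local v)))
    (hginv : ∀ u ∈ cmLocalIntegralLevel L 3 H' v, ∀ x, g (u * x * u⁻¹) = g x)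
    (_hg1 : ∀ u : (cmDatum L 3 H').Local v,
      (∀ a b, Valued.v (((toPlace v w (HeckeCharacter.uniformizer ↥(maximalRealSubfield L) v : v.adicCompletion ↥(maximalRealSubfield L))) ^ 1)⁻¹ *
        ((((localNonsplitEquiv (IsCMField.complexConj L) H' (IsCMField.complexConj_ne_one L) w hw u :
            ↥(unitaryGroupOfForm (galAdicCompletionMap (L := L) (IsCMField.complexConj L) hw) (placeForm H' w.1))) : GL (Fin 3) (w.1.adicCompletion L)) :
              Matrix (Fin 3) (Fin 3) (w.1.adicCompletion L)) a b - (1 : Matrix (Fin 3) (Fin 3) (w.1.adicCompletion L)) a b)) ≤ 1) →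
      ∀ x, g (u * x) = g x)
    -- the two-layer strata values of `g` (★ F0P2-p01 head rows VERBATIM, in the (L)-ram L5-C2 binder shapes)
    (c₂ : ℂ) (c' : ℕ → ℂ) (hc : ∀ x : ((cmDatum L 3 H').Local v), (x ∈ cmLocalIntegralLevel L 3 H' v ∧ (redMat (((x).val : GL (Fin 3) (UnitaryGroup.LocalRing L v)).val.map (Pi.evalRingHom (fun w' : PlacesOver L v => w'.1.adicCompletion L) w)) - 1) ^ 3 = 0 ∧ (redMat (((x).val : GL (Fin 3) (UnitaryGroup.LocalRing L v)).val.map (Pi.evalRingHom (fun w' : PlacesOver L v => w'.1.adicCompletion L) w)) - 1).rank = 2 ∧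
        ∃ y : ((cmDatum L 3 H').Local v), (∀ a b, Valued.v (((toPlace v w (HeckeCharacter.uniformizer ↥(maximalRealSubfield L) v : v.adicCompletion ↥(maximalRealSubfield L))) ^ 1)⁻¹ *
        ((((localNonsplitEquiv (IsCMField.complexConj L) H' (IsCMField.complexConj_ne_one L) w hw (y * x * y⁻¹) :
            ↥(unitaryGroupOfForm (galAdicCompletionMap (L := L) (IsCMField.complexConj L) hw) (placeForm H' w.1))) : GL (Fin 3) (w.1.adicCompletion L)) :
              Matrix (Fin 3) (Fin 3) (w.1.adicCompletion L)) a b - (1 : Matrix (Fin 3) (Fin 3) (w.1.adicCompletion L)) a b)) ≤ 1)) → g x = c₂)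
    (hc' : ((∀ x : ((cmDatum L 3 H').Local v), (x ∈ cmLocalIntegralLevel L 3 H' v ∧ (∀ a b, Valued.v (ϖ⁻¹ * ((((x).val : GL (Fin 3) (UnitaryGroup.LocalRing L v)).val.map (Pi.evalRingHom (fun w' : PlacesOver L v => w'.1.adicCompletion L) w)) a b - (1 : Matrix (Fin 3) (Fin 3) (w.1.adicCompletion L)) a b)) ≤ 1) ∧
        (redMat (ϖ⁻¹ • ((((x).val : GL (Fin 3) (UnitaryGroup.LocalRing L v)).val.map (Pi.evalRingHom (fun w' : PlacesOver L v => w'.1.adicCompletion L) w)) - 1))) ^ 3 = 0 ∧ (redMat (ϖ⁻¹ • ((((x).val : GL (Fin 3) (UnitaryGroup.LocalRing L v)).val.map (Pi.evalRingHom (fun w' : PlacesOver L v => w'.1.adicCompletion L) w)) - 1))).rank = 0) → g x = c' 0) ∧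
      (∀ x : ((cmDatum L 3 H').Local v), (x ∈ cmLocalIntegralLevel L 3 H' v ∧ (∀ a b, Valued.v (ϖ⁻¹ * ((((x).val : GL (Fin 3) (UnitaryGroup.LocalRing L v)).val.map (Pi.evalRingHom (fun w' : PlacesOver L v => w'.1.adicCompletion L) w)) a b - (1 : Matrix (Fin 3) (Fin 3) (w.1.adicCompletion L)) a b)) ≤ 1) ∧
        (redMat (ϖ⁻¹ • ((((x).val : GL (Fin 3) (UnitaryGroup.LocalRing L v)).val.map (Pi.evalRingHom (fun w' : PlacesOver L v => w'.1.adicCompletion L) w)) - 1))) ^ 3 = 0 ∧ (redMat (ϖ⁻¹ • ((((x).val : GL (Fin 3) (UnitaryGroup.LocalRing L v)).val.map (Pi.evalRingHom (fun w' : PlacesOver L v => w'.1.adicCompletion L) w)) - 1))).rank = 2) → g x = c' 2)))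
    (c₁s c₁n : ℂ)
    (hR4s : (∀ (x : ((cmDatum L 3 H').Local v)) (z : Fin 3 → 𝓀[(w.1.adicCompletion L)]), (x ∈ cmLocalIntegralLevel L 3 H' v ∧
        (∀ a b, Valued.v (ϖ⁻¹ * ((((x).val : GL (Fin 3) (UnitaryGroup.LocalRing L v)).val.map (Pi.evalRingHom (fun w' : PlacesOver L v => w'.1.adicCompletion L) w)) a b - (1 : Matrix (Fin 3) (Fin 3) (w.1.adicCompletion L)) a b)) ≤ 1) ∧
        (redMat (ϖ⁻¹ • ((((x).val : GL (Fin 3) (UnitaryGroup.LocalRing L v)).val.map (Pi.evalRingHom (fun w' : PlacesOver L v => w'.1.adicCompletion L) w)) - 1))) ^ 3 = 0 ∧ (redMat (ϖ⁻¹ • ((((x).val : GL (Fin 3) (UnitaryGroup.LocalRing L v)).val.map (Pi.evalRingHom (fun w' : PlacesOver L v => w'.1.adicCompletion L) w)) - 1))).rank = 1 ∧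
        z ⬝ᵥ ((redMat (placeForm H' w.1) * redMat (ϖ⁻¹ • ((((x).val : GL (Fin 3) (UnitaryGroup.LocalRing L v)).val.map (Pi.evalRingHom (fun w' : PlacesOver L v => w'.1.adicCompletion L) w)) - 1))) *ᵥ z) ≠ 0 ∧ IsSquare (z ⬝ᵥ ((redMat (placeForm H' w.1) * redMat (ϖ⁻¹ • ((((x).val : GL (Fin 3) (UnitaryGroup.LocalRing L v)).val.map (Pi.evalRingHom (fun w' : PlacesOver L v => w'.1.adicCompletion L) w)) - 1))) *ᵥ z))) →
        g x = c₁s))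
    (hR4n : (∀ (x : ((cmDatum L 3 H').Local v)) (z : Fin 3 → 𝓀[(w.1.adicCompletion L)]), (x ∈ cmLocalIntegralLevel L 3 H' v ∧
        (∀ a b, Valued.v (ϖ⁻¹ * ((((x).val : GL (Fin 3) (UnitaryGroup.LocalRing L v)).val.map (Pi.evalRingHom (fun w' : PlacesOver L v => w'.1.adicCompletion L) w)) a b - (1 : Matrix (Fin 3) (Fin 3) (w.1.adicCompletion L)) a b)) ≤ 1) ∧
        (redMat (ϖ⁻¹ • ((((x).val : GL (Fin 3) (UnitaryGroup.LocalRing L v)).val.map (Pi.evalRingHom (fun w' : PlacesOver L v => w'.1.adicCompletion L) w)) - 1))) ^ 3 = 0 ∧ (redMat (ϖ⁻¹ • ((((x).val : GL (Fin 3) (UnitaryGroup.LocalRing L v)).val.map (Pi.evalRingHom (fun w' : PlacesOver L v => w'.1.adicCompletion L) w)) - 1))).rank = 1 ∧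
        z ⬝ᵥ ((redMat (placeForm H' w.1) * redMat (ϖ⁻¹ • ((((x).val : GL (Fin 3) (UnitaryGroup.LocalRing L v)).val.map (Pi.evalRingHom (fun w' : PlacesOver L v => w'.1.adicCompletion L) w)) - 1))) *ᵥ z) ≠ 0 ∧ ¬ IsSquare (z ⬝ᵥ ((redMat (placeForm H' w.1) * redMat (ϖ⁻¹ • ((((x).val : GL (Fin 3) (UnitaryGroup.LocalRing L v)).val.map (Pi.evalRingHom (fun w' : PlacesOver L v => w'.1.adicCompletion L) w)) - 1))) *ᵥ z))) →
        g x = c₁n))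
    -- `y_λ ∈ L⁺_v` with `ι_w y_λ = −det H′_w` (the C-Δ Levi value's Hilbert symbol `(y_λ, θ)_v`)
    (yl : v.adicCompletion ↥(maximalRealSubfield L)) (_hyl : toPlace v w yl = -(placeForm H' w.1).det)
    -- SOCKET (Lit2) «TYPE-(2) v-DEEP REPRESENTATIVES»: both matched classes of `γ_H` contain v-deep elements (the type-(2) literals; type-(2) twin of ★ p846967)
    (hLit : ∀ ⦃γH : ((cmDatum L 2 (Matrix.of fun i j : Fin 2 => if i.val + j.val + 1 = 2 then (1 : L) else 0)).Local v × (cmDatum L 1 (Matrix.of fun i j : Fin 1 => if i.val + j.val + 1 = 1 then (1 : L) else 0)).Local v)⦄,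
      (∀ i j : Fin 2, Valued.v (((((γH.1.val : GL (Fin 2) (UnitaryGroup.LocalRing L v)).val.map (Pi.evalRingHom (fun w' : PlacesOver L v => w'.1.adicCompletion L) w))) - 1) i j) ≤ Valued.v (ϖ ^ 2)) → Valued.v (finGammaTwo L v γH w - 1) ≤ Valued.v (ϖ ^ 2) → IsLocalGRegular L v γH →
      (¬ ∃ x : (w.1.adicCompletion L), ((((γH.1.val : GL (Fin 2) (UnitaryGroup.LocalRing L v)).val.map (Pi.evalRingHom (fun w' : PlacesOver L v => w'.1.adicCompletion L) w))).charpoly).IsRoot x) → ∀ ⦃n : ℕ⦄,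
      Valued.v ((((γH.1.val : GL (Fin 2) (UnitaryGroup.LocalRing L v)).val.map (Pi.evalRingHom (fun w' : PlacesOver L v => w'.1.adicCompletion L) w))).trace ^ 2 - 4 * (((γH.1.val : GL (Fin 2) (UnitaryGroup.LocalRing L v)).val.map (Pi.evalRingHom (fun w' : PlacesOver L v => w'.1.adicCompletion L) w))).det) = WithZero.exp (-((2 * (2 * n) : ℕ) : ℤ)) → 1 ≤ n → 
      ∃ tp tm : ((cmDatum L 3 H').Local v), IsLocalNormPair L H' v γH tp ∧ IsLocalNormPair L H' v γH tm ∧ finKappaAt L v H' γH tp = 1 ∧ finKappaAt L v H' γH tm = -1 ∧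
        (∀ a b, Valued.v (((toPlace v w (HeckeCharacter.uniformizer ↥(maximalRealSubfield L) v : v.adicCompletion ↥(maximalRealSubfield L))) ^ 1)⁻¹ * ((((tp).val : GL (Fin 3) (UnitaryGroup.LocalRing L v)).val.map (Pi.evalRingHom (fun w' : PlacesOver L v => w'.1.adicCompletion L) w)) a b - (1 : Matrix (Fin 3) (Fin 3) (w.1.adicCompletion L)) a b)) ≤ 1) ∧ (∀ a b, Valued.v (((toPlace v w (HeckeCharacter.uniformizer ↥(maximalRealSubfield L) v : v.adicCompletion ↥(maximalRealSubfield L))) ^ 1)⁻¹ * ((((tm).val : GL (Fin 3) (UnitaryGroup.LocalRing L v)).val.map (Pi.evalRingHom (fun w' : PlacesOver L v => w'.1.adicCompletion L) w)) a b - (1 : Matrix (Fin 3) (Fin 3) (w.1.adicCompletion L)) a b)) ≤ 1))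
    -- SOCKET (Cnt2-even) «SIGNED STRATA COUNT LAWS»: `τ_v·D_v·(n_j(t₊) − n_j(t₋)) = (y_λ,θ)_v·X̃_j(n)` for the five strata (p07 (g13) ledger v1.3 rows bd ∕ reg ∕ 1± ∕ 0 × the `τ·D` dictionary)
    (hCnt : ∀ ⦃γH : ((cmDatum L 2 (Matrix.of fun i j : Fin 2 => if i.val + j.val + 1 = 2 then (1 : L) else 0)).Local v × (cmDatum L 1 (Matrix.of fun i j : Fin 1 => if i.val + j.val + 1 = 1 then (1 : L) else 0)).Local v)⦄,
      (∀ i j : Fin 2, Valued.v (((((γH.1.val : GL (Fin 2) (UnitaryGroup.LocalRing L v)).val.map (Pi.evalRingHom (fun w' : PlacesOver L v => w'.1.adicCompletion L) w))) - 1) i j) ≤ Valued.v (ϖ ^ 2)) → Valued.v (finGammaTwo L v γH w - 1) ≤ Valued.v (ϖ ^ 2) → IsLocalGRegular L v γH →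
      (¬ ∃ x : (w.1.adicCompletion L), ((((γH.1.val : GL (Fin 2) (UnitaryGroup.LocalRing L v)).val.map (Pi.evalRingHom (fun w' : PlacesOver L v => w'.1.adicCompletion L) w))).charpoly).IsRoot x) → ∀ ⦃n : ℕ⦄,
      Valued.v ((((γH.1.val : GL (Fin 2) (UnitaryGroup.LocalRing L v)).val.map (Pi.evalRingHom (fun w' : PlacesOver L v => w'.1.adicCompletion L) w))).trace ^ 2 - 4 * (((γH.1.val : GL (Fin 2) (UnitaryGroup.LocalRing L v)).val.map (Pi.evalRingHom (fun w' : PlacesOver L v => w'.1.adicCompletion L) w))).det) = WithZero.exp (-((2 * (2 * n) : ℕ) : ℤ)) → 1 ≤ n →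
      ∀ (m : ℕ), Valued.v (((finCharpolyTwo L v γH).eval (finGammaTwo L v γH)) w) =
          Valued.v ((toPlace v w (HeckeCharacter.uniformizer ↥(maximalRealSubfield L) v : v.adicCompletion ↥(maximalRealSubfield L))) ^ m) →
        ∀ β : (v.adicCompletion ↥(maximalRealSubfield L))ˣ,
          toPlace v w (β : v.adicCompletion ↥(maximalRealSubfield L)) =
            -(((finCharpolyTwo L v γH).eval (finGammaTwo L v γH)) w *
                (finGammaTwo L v γH w ^ 2 +
                  ((γH.1.val.val : Matrix (Fin 2) (Fin 2) (LocalRing L v)).map (Pi.evalRingHom (fun w' : PlacesOver L v => w'.1.adicCompletion L) w)).det)) /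
              (2 * finGammaTwo L v γH w ^ 2 *
                ((γH.1.val.val : Matrix (Fin 2) (Fin 2) (LocalRing L v)).map (Pi.evalRingHom (fun w' : PlacesOver L v => w'.1.adicCompletion L) w)).det) →
      ∀ tp tm : ((cmDatum L 3 H').Local v), IsLocalNormPair L H' v γH tp → IsLocalNormPair L H' v γH tm → finKappaAt L v H' γH tp = 1 → finKappaAt L v H' γH tm = -1 →
        (∀ a b, Valued.v (((toPlace v w (HeckeCharacter.uniformizer ↥(maximalRealSubfield L) v : v.adicCompletion ↥(maximalRealSubfield L))) ^ 1)⁻¹ * ((((tp).val : GL (Fin 3) (UnitaryGroup.LocalRing L v)).val.map (Pi.evalRingHom (fun w' : PlacesOver L v => w'.1.adicCompletion L) w)) a b - (1 : Matrix (Fin 3) (Fin 3) (w.1.adicCompletion L)) a b)) ≤ 1) → (∀ a b, Valued.v (((toPlace v w (HeckeCharacter.uniformizer ↥(maximalRealSubfield L) v : v.adicCompletion ↥(maximalRealSubfield L))) ^ 1)⁻¹ * ((((tm).val : GL (Fin 3) (UnitaryGroup.LocalRing L v)).val.map (Pi.evalRingHom (fun w' : PlacesOver L v => w'.1.adicCompletion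 L) w)) a b - (1 : Matrix (Fin 3) (Fin 3) (w.1.adicCompletion L)) a b)) ≤ 1) →
        ((hilbertSymbol (v.adicCompletion ↥(maximalRealSubfield L)) (β : v.adicCompletion ↥(maximalRealSubfield L))
        (algebraMap ↥(maximalRealSubfield L) _ ((cmQuadraticGenerator L : 𝓞 ↥(maximalRealSubfield L)) : ↥(maximalRealSubfield L))) : ℂ) * ((Ideal.absNorm v.asIdeal : ℂ) ^ m)⁻¹) * (({q : (((cmDatum L 3 H').Local v) ⧸ cmLocalIntegralLevel L 3 H' v) | q ∈ MulAction.fixedBy (((cmDatum L 3 H').Local v) ⧸ cmLocalIntegralLevel L 3 H' v) tp ∧ (redMat (((((q.out⁻¹ * tp * q.out)).val : GL (Fin 3) (UnitaryGroup.LocalRing L v)).val.map (Pi.evalRingHom (fun w' : PlacesOver L v => w'.1.adicCompletion L) w))) - 1).rank = 2}.ncard : ℂ) - ({q : (((cmDatum L 3 H').Local v) ⧸ cmLocalIntegralLevel L 3 H' v) | q ∈ MulAction.fixedBy (((cmDatum L 3 H').Local v) ⧸ cmLocalIntegralLevel L 3 H' v) tm ∧ (redMat (((((q.out⁻¹ *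 tm * q.out)).val : GL (Fin 3) (UnitaryGroup.LocalRing L v)).val.map (Pi.evalRingHom (fun w' : PlacesOver L v => w'.1.adicCompletion L) w))) - 1).rank = 2}.ncard : ℂ)) = (hilbertSymbol (v.adicCompletion ↥(maximalRealSubfield L)) yl
        (algebraMap ↥(maximalRealSubfield L) _ ((cmQuadraticGenerator L : 𝓞 ↥(maximalRealSubfield L)) : ↥(maximalRealSubfield L))) : ℂ) * (((Ideal.absNorm v.asIdeal : ℂ) + 1) * (Ideal.absNorm v.asIdeal : ℂ) ^ n / (Ideal.absNorm v.asIdeal : ℂ)) ∧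
        ((hilbertSymbol (v.adicCompletion ↥(maximalRealSubfield L)) (β : v.adicCompletion ↥(maximalRealSubfield L))
        (algebraMap ↥(maximalRealSubfield L) _ ((cmQuadraticGenerator L : 𝓞 ↥(maximalRealSubfield L)) : ↥(maximalRealSubfield L))) : ℂ) * ((Ideal.absNorm v.asIdeal : ℂ) ^ m)⁻¹) * (({q : (((cmDatum L 3 H').Local v) ⧸ cmLocalIntegralLevel L 3 H' v) | q ∈ MulAction.fixedBy (((cmDatum L 3 H').Local v) ⧸ cmLocalIntegralLevel L 3 H' v) tp ∧ (redMat (((((q.out⁻¹ * tp * q.out)).val : GL (Fin 3) (UnitaryGroup.LocalRing L v)).val.map (Pi.evalRingHom (fun w' : PlacesOver L v => w'.1.adicCompletion L) w))) - 1).rank = 0 ∧ (redMat (ϖ⁻¹ • (((((q.out⁻¹ * tp * q.out)).val : GL (Fin 3) (UnitaryGroup.LocalRing L v)).val.map (Pi.evalRingHom (fun w' : PlacesOver L v => w'.1.adicCompletion L) w)) - 1))).rank = 2}.ncard : ℂ) - ({q : (((cmDatum L 3 H').Local v) ⧸ cmLocalIntegralLevel L 3 H' v) | q ∈ MulAction.fixedBy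 (((cmDatum L 3 H').Local v) ⧸ cmLocalIntegralLevel L 3 H' v) tm ∧ (redMat (((((q.out⁻¹ * tm * q.out)).val : GL (Fin 3) (UnitaryGroup.LocalRing L v)).val.map (Pi.evalRingHom (fun w' : PlacesOver L v => w'.1.adicCompletion L) w))) - 1).rank = 0 ∧ (redMat (ϖ⁻¹ • (((((q.out⁻¹ * tm * q.out)).val : GL (Fin 3) (UnitaryGroup.LocalRing L v)).val.map (Pi.evalRingHom (fun w' : PlacesOver L v => w'.1.adicCompletion L) w)) - 1))).rank = 2}.ncard : ℂ)) = (hilbertSymbol (v.adicCompletion ↥(maximalRealSubfield L)) yl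
        (algebraMap ↥(maximalRealSubfield L) _ ((cmQuadraticGenerator L : 𝓞 ↥(maximalRealSubfield L)) : ↥(maximalRealSubfield L))) : ℂ) * (((Ideal.absNorm v.asIdeal : ℂ) + 1) * (Ideal.absNorm v.asIdeal : ℂ) ^ n / (Ideal.absNorm v.asIdeal : ℂ) ^ 2) ∧
        ((hilbertSymbol (v.adicCompletion ↥(maximalRealSubfield L)) (β : v.adicCompletion ↥(maximalRealSubfield L))
        (algebraMap ↥(maximalRealSubfield L) _ ((cmQuadraticGenerator L : 𝓞 ↥(maximalRealSubfield L)) : ↥(maximalRealSubfield L))) : ℂ) * ((Ideal.absNorm v.asIdeal : ℂ) ^ m)⁻¹) * (({q : (((cmDatum L 3 H').Local v) ⧸ cmLocalIntegralLevel L 3 H' v) | q ∈ MulAction.fixedBy (((cmDatum L 3 H').Local v) ⧸ cmLocalIntegralLevel L 3 H' v) tp ∧ (redMat (((((q.out⁻¹ * tp * q.out)).val : GL (Fin 3) (UnitaryGroup.LocalRing L v)).val.map (Pi.evalRingHom (fun w' : PlacesOver L v => w'.1.adicCompletion L) w))) - 1).rank = 0 ∧ (redMat (ϖ⁻¹ •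 (((((q.out⁻¹ * tp * q.out)).val : GL (Fin 3) (UnitaryGroup.LocalRing L v)).val.map (Pi.evalRingHom (fun w' : PlacesOver L v => w'.1.adicCompletion L) w)) - 1))).rank = 1 ∧ ∃ (z : Fin 3 → 𝓀[(w.1.adicCompletion L)]) (a : 𝓀[(w.1.adicCompletion L)]), a ≠ 0 ∧ z ⬝ᵥ ((redMat (placeForm H' w.1) * redMat (ϖ⁻¹ • (((((q.out⁻¹ * tp * q.out)).val : GL (Fin 3) (UnitaryGroup.LocalRing L v)).val.map (Pi.evalRingHom (fun w' : PlacesOver L v => w'.1.adicCompletion L) w)) - 1))) *ᵥ z) = a ^ 2}.ncard : ℂ) - ({q : (((cmDatum L 3 H').Local v) ⧸ cmLocalIntegralLevel L 3 H' v) | q ∈ MulAction.fixedBy (((cmDatum L 3 H').Local v) ⧸ cmLocalIntegralLevel L 3 H' v) tm ∧ (redMat (((((q.out⁻¹ * tm * q.out)).val : GL (Fin 3) (UnitaryGroup.LocalRing L v)).val.map (Pi.evalRingHom (fun w' : PlacesOver L v => w'.1.adicCompletion L) w))) - 1).rank = 0 ∧ (redMat (ϖ⁻¹ • (((((q.out⁻¹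 * tm * q.out)).val : GL (Fin 3) (UnitaryGroup.LocalRing L v)).val.map (Pi.evalRingHom (fun w' : PlacesOver L v => w'.1.adicCompletion L) w)) - 1))).rank = 1 ∧ ∃ (z : Fin 3 → 𝓀[(w.1.adicCompletion L)]) (a : 𝓀[(w.1.adicCompletion L)]), a ≠ 0 ∧ z ⬝ᵥ ((redMat (placeForm H' w.1) * redMat (ϖ⁻¹ • (((((q.out⁻¹ * tm * q.out)).val : GL (Fin 3) (UnitaryGroup.LocalRing L v)).val.map (Pi.evalRingHom (fun w' : PlacesOver L v => w'.1.adicCompletion L) w)) - 1))) *ᵥ z) = a ^ 2}.ncard : ℂ)) = (hilbertSymbol (v.adicCompletion ↥(maximalRealSubfield L)) yl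
        (algebraMap ↥(maximalRealSubfield L) _ ((cmQuadraticGenerator L : 𝓞 ↥(maximalRealSubfield L)) : ↥(maximalRealSubfield L))) : ℂ) * (((Ideal.absNorm v.asIdeal : ℂ) + 1) * ((Ideal.absNorm v.asIdeal : ℂ) ^ n - 2 * (Ideal.absNorm v.asIdeal : ℂ)) / (2 * (Ideal.absNorm v.asIdeal : ℂ) ^ 3)) ∧
        ((hilbertSymbol (v.adicCompletion ↥(maximalRealSubfield L)) (β : v.adicCompletion ↥(maximalRealSubfield L))
        (algebraMap ↥(maximalRealSubfield L) _ ((cmQuadraticGenerator L : 𝓞 ↥(maximalRealSubfield L)) : ↥(maximalRealSubfield L))) : ℂ) * ((Ideal.absNorm v.asIdeal : ℂ) ^ m)⁻¹) * (({q : (((cmDatum L 3 H').Local v) ⧸ cmLocalIntegralLevel L 3 H' v) | q ∈ MulAction.fixedBy (((cmDatum L 3 H').Local v) ⧸ cmLocalIntegralLevel L 3 H' v) tp ∧ (redMat (((((q.out⁻¹ * tp * q.out)).val : GL (Fin 3) (UnitaryGroup.LocalRing L v)).val.map (Pi.evalRingHom (fun w' : PlacesOver L v => w'.1.adicCompletion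 L) w))) - 1).rank = 0 ∧ (redMat (ϖ⁻¹ • (((((q.out⁻¹ * tp * q.out)).val : GL (Fin 3) (UnitaryGroup.LocalRing L v)).val.map (Pi.evalRingHom (fun w' : PlacesOver L v => w'.1.adicCompletion L) w)) - 1))).rank = 1 ∧ ¬ ∃ (z : Fin 3 → 𝓀[(w.1.adicCompletion L)]) (a : 𝓀[(w.1.adicCompletion L)]), a ≠ 0 ∧ z ⬝ᵥ ((redMat (placeForm H' w.1) * redMat (ϖ⁻¹ • (((((q.out⁻¹ * tp * q.out)).val : GL (Fin 3) (UnitaryGroup.LocalRing L v)).val.map (Pi.evalRingHom (fun w' : PlacesOver L v => w'.1.adicCompletion L) w)) - 1))) *ᵥ z) = a ^ 2}.ncard : ℂ) - ({q : (((cmDatum L 3 H').Local v) ⧸ cmLocalIntegralLevel L 3 H' v) | q ∈ MulAction.fixedBy (((cmDatum L 3 H').Local v) ⧸ cmLocalIntegralLevel L 3 H' v) tm ∧ (redMat (((((q.out⁻¹ * tm * q.out)).val : GL (Fin 3) (UnitaryGroup.LocalRing L v)).val.map (Pi.evalRingHom (fun w' : PlacesOver L v => w'.1.adicCompletion L) w)))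 - 1).rank = 0 ∧ (redMat (ϖ⁻¹ • (((((q.out⁻¹ * tm * q.out)).val : GL (Fin 3) (UnitaryGroup.LocalRing L v)).val.map (Pi.evalRingHom (fun w' : PlacesOver L v => w'.1.adicCompletion L) w)) - 1))).rank = 1 ∧ ¬ ∃ (z : Fin 3 → 𝓀[(w.1.adicCompletion L)]) (a : 𝓀[(w.1.adicCompletion L)]), a ≠ 0 ∧ z ⬝ᵥ ((redMat (placeForm H' w.1) * redMat (ϖ⁻¹ • (((((q.out⁻¹ * tm * q.out)).val : GL (Fin 3) (UnitaryGroup.LocalRing L v)).val.map (Pi.evalRingHom (fun w' : PlacesOver L v => w'.1.adicCompletion L) w)) - 1))) *ᵥ z) = a ^ 2}.ncard : ℂ)) = (hilbertSymbol (v.adicCompletion ↥(maximalRealSubfield L)) yl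
        (algebraMap ↥(maximalRealSubfield L) _ ((cmQuadraticGenerator L : 𝓞 ↥(maximalRealSubfield L)) : ↥(maximalRealSubfield L))) : ℂ) * (((Ideal.absNorm v.asIdeal : ℂ) + 1) * ((Ideal.absNorm v.asIdeal : ℂ) ^ n - 2 * (Ideal.absNorm v.asIdeal : ℂ)) / (2 * (Ideal.absNorm v.asIdeal : ℂ) ^ 3)) ∧
        ((hilbertSymbol (v.adicCompletion ↥(maximalRealSubfield L)) (β : v.adicCompletion ↥(maximalRealSubfield L))
        (algebraMap ↥(maximalRealSubfield L) _ ((cmQuadraticGenerator L : 𝓞 ↥(maximalRealSubfield L)) : ↥(maximalRealSubfield L))) : ℂ) * ((Ideal.absNorm v.asIdeal : ℂ) ^ m)⁻¹) * (({q : (((cmDatum L 3 H').Local v) ⧸ cmLocalIntegralLevel L 3 H' v) | q ∈ MulAction.fixedBy (((cmDatum L 3 H').Local v) ⧸ cmLocalIntegralLevel L 3 H' v) tp ∧ (redMat (((((q.out⁻¹ * tp * q.out)).val : GL (Fin 3) (UnitaryGroup.LocalRing L v)).val.map (Pi.evalRingHom (fun w' : PlacesOver L v => w'.1.adicCompletion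 L) w))) - 1).rank = 0 ∧ (redMat (ϖ⁻¹ • (((((q.out⁻¹ * tp * q.out)).val : GL (Fin 3) (UnitaryGroup.LocalRing L v)).val.map (Pi.evalRingHom (fun w' : PlacesOver L v => w'.1.adicCompletion L) w)) - 1))).rank = 0}.ncard : ℂ) - ({q : (((cmDatum L 3 H').Local v) ⧸ cmLocalIntegralLevel L 3 H' v) | q ∈ MulAction.fixedBy (((cmDatum L 3 H').Local v) ⧸ cmLocalIntegralLevel L 3 H' v) tm ∧ (redMat (((((q.out⁻¹ * tm * q.out)).val : GL (Fin 3) (UnitaryGroup.LocalRing L v)).val.map (Pi.evalRingHom (fun w' : PlacesOver L v => w'.1.adicCompletion L) w))) - 1).rank = 0 ∧ (redMat (ϖ⁻¹ • (((((q.out⁻¹ * tm * q.out)).val : GL (Fin 3) (UnitaryGroup.LocalRing L v)).val.map (Pi.evalRingHom (fun w' : PlacesOver L v => w'.1.adicCompletion L) w)) - 1))).rank = 0}.ncard : ℂ)) = (hilbertSymbol (v.adicCompletion ↥(maximalRealSubfield L)) yl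
        (algebraMap ↥(maximalRealSubfield L) _ ((cmQuadraticGenerator L : 𝓞 ↥(maximalRealSubfield L)) : ↥(maximalRealSubfield L))) : ℂ) * (((((Ideal.absNorm v.asIdeal : ℂ) + 1) * ∑ k ∈ Finset.range n, (Ideal.absNorm v.asIdeal : ℂ) ^ k) - 1) / (Ideal.absNorm v.asIdeal : ℂ) ^ 3)) :
    (∃ V ∈ 𝓝 (1 : ((cmDatum L 2 (Matrix.of fun i j : Fin 2 => if i.val + j.val + 1 = 2 then (1 : L) else 0)).Local v × (cmDatum L 1 (Matrix.of fun i j : Fin 1 => if i.val + j.val + 1 = 1 then (1 : L) else 0)).Local v)), ∀ γH ∈ V, IsLocalGRegular L v γH →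
      ¬ (∃ x : (w.1.adicCompletion L), ((((γH.1.val : GL (Fin 2) (UnitaryGroup.LocalRing L v)).val.map (Pi.evalRingHom (fun w' : PlacesOver L v => w'.1.adicCompletion L) w))).charpoly).IsRoot x) →
      ∀ n : ℕ, Valued.v ((((γH.1.val : GL (Fin 2) (UnitaryGroup.LocalRing L v)).val.map (Pi.evalRingHom (fun w' : PlacesOver L v => w'.1.adicCompletion L) w))).trace ^ 2 - 4 * (((γH.1.val : GL (Fin 2) (UnitaryGroup.LocalRing L v)).val.map (Pi.evalRingHom (fun w' : PlacesOver L v => w'.1.adicCompletion L) w))).det) = WithZero.exp (-((2 * (2 * n) : ℕ) : ℤ)) → 1 ≤ n →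
      ∑ᶠ cG : ConjClasses ((cmDatum L 3 H').Local v),
              ((finExplicitCollection L H' μ (finExplicitDelta_conj_left_all L H' μ) (finExplicitDelta_conj_right_all L H' μ)) v).Δ γH (Quotient.out cG) *
                classOrbitalIntegral mG g cG =
        (hilbertSymbol (v.adicCompletion ↥(maximalRealSubfield L)) yl
          (algebraMap ↥(maximalRealSubfield L) _ ((cmQuadraticGenerator L : 𝓞 ↥(maximalRealSubfield L)) : ↥(maximalRealSubfield L))) : ℂ) *
            (νG.real (cmLocalIntegralLevel L 3 H' v : Set ((cmDatum L 3 H').Local v)) : ℂ) *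
            (c₂ * (((Ideal.absNorm v.asIdeal : ℂ) + 1) * (Ideal.absNorm v.asIdeal : ℂ) ^ n / (Ideal.absNorm v.asIdeal : ℂ)) + c' 2 * (((Ideal.absNorm v.asIdeal : ℂ) + 1) * (Ideal.absNorm v.asIdeal : ℂ) ^ n / (Ideal.absNorm v.asIdeal : ℂ) ^ 2) +
              c₁s * (((Ideal.absNorm v.asIdeal : ℂ) + 1) * ((Ideal.absNorm v.asIdeal : ℂ) ^ n - 2 * (Ideal.absNorm v.asIdeal : ℂ)) / (2 * (Ideal.absNorm v.asIdeal : ℂ) ^ 3)) + c₁n * (((Ideal.absNorm v.asIdeal : ℂ) + 1) * ((Ideal.absNorm v.asIdeal : ℂ) ^ n - 2 * (Ideal.absNorm v.asIdeal : ℂ)) / (2 * (Ideal.absNorm v.asIdeal : ℂ) ^ 3)) +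
              c' 0 * (((((Ideal.absNorm v.asIdeal : ℂ) + 1) * ∑ k ∈ Finset.range n, (Ideal.absNorm v.asIdeal : ℂ) ^ k) - 1) / (Ideal.absNorm v.asIdeal : ℂ) ^ 3))) := by
  classical
  have hϖ0 : ϖ ≠ 0 := by
    intro h0
    rw [h0, map_zero] at hϖ
    exact WithZero.coe_ne_zero hϖ.symm
  -- the μ-DEPENDENT neighbourhood on which the tokens exist and `τ·D = (β, θ)_v · q^{−m}` (★ p847488), intersected with the 2-deep tube
  obtain ⟨VS, hVS, hS⟩ := exists_nhds_one_forall_tokens_finTau_mul_finWeylRatio_eq L v w hw μ hμω h2 H'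
  refine ⟨_ ∩ VS, Filter.inter_mem (setOf_entrywise_deep_mem_nhds_one L v w (c := ϖ ^ 2) (pow_ne_zero 2 hϖ0)) hVS, ?_⟩
  intro γH hγV hreg hirr n hN hn1
  obtain ⟨⟨htube, hu⟩, hγS⟩ := hγV
  obtain ⟨m, β, hm, hβ, hτD⟩ := hS γH hγS hreg
  -- `det H′ ≠ 0`, `H′` invertible
  have hdet : H'.det ≠ 0 := by
    intro h0
    have hu := (Matrix.isUnit_iff_isUnit_det _).1 hH'w
    have hd : ((placeForm H' w.1)).det = 0 := by
      rw [placeForm, ← RingHom.mapMatrix_apply, ← RingHom.map_det, h0, map_zero]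
    exact hu.ne_zero hd
  have hH'u : IsUnit H' := (Matrix.isUnit_iff_isUnit_det H').2 (isUnit_iff_ne_zero.2 hdet)
  -- (Lit2): the two v-deep literals and (Cnt2): their signed count laws
  obtain ⟨tp, tm, htp, htm, hκp, hκm, hdp, hdm⟩ := hLit htube hu hreg hirr hN hn1
  obtain ⟨hbd, hrg, hsq, hns, h0⟩ := hCnt htube hu hreg hirr hN hn1 m hm β hβ tp tm htp htm hκp hκm hdp hdm
  -- the two classes: `Σᶠ Δ·Φ = τ·D·(Φ(⟦δ₊⟧) − Φ(⟦δ₋⟧))`, `⟦δ_±⟧ = ⟦t_±⟧`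
  obtain ⟨δp, δm, -, -, -, -, hexp, hexm, hsum⟩ :=
    exists_signedPair_finsum_delta_mul_classOrbitalIntegral_eq_mul_sub_of_frame L H' hH' hdet w hw hH'w A hframe μ
      (finExplicitDelta_conj_left_all L H' μ) (finExplicitDelta_conj_right_all L H' μ) hirr
  rw [hsum mG g, ConjClasses.mk_eq_mk_iff_isConj.2 (hexp tp htp hκp), ConjClasses.mk_eq_mk_iff_isConj.2 (hexm tm htm hκm)]
  -- the scalar: `τ·D = (β, θ)_v · q^{−m}` read off the `κ = +1` literal
  rw [hτD tp htp (Or.inl hκp)]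
  -- the conversion at `t₊`, `t₋`
  haveI := compactSpace_centralizer_of_isLocalNormPair_of_not_exists_isRoot_nonsplit L v w hw hH'u hreg hirr tp htp
  haveI := compactSpace_centralizer_of_isLocalNormPair_of_not_exists_isRoot_nonsplit L v w hw hH'u hreg hirr tm htm
  have hregp : IsRegularElt (tp.val : GL (Fin 3) (UnitaryGroup.LocalRing L v)) := isRegularElt_of_isLocalNormPair L H' v htp hreg
  have hregm : IsRegularElt (tm.val : GL (Fin 3) (UnitaryGroup.LocalRing L v)) := isRegularElt_of_isLocalNormPair L H' v htm hreg
  -- a residue non-square `ε` (odd residue characteristic)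
  have h2k : (2 : 𝓀[(w.1.adicCompletion L)]) ≠ 0 := by
    have h := h2.map (IsLocalRing.residue 𝒪[(w.1.adicCompletion L)])
    rw [map_ofNat] at h
    exact h.ne_zero
  letI : Fintype 𝓀[(w.1.adicCompletion L)] := Fintype.ofFinite _
  have hchar : ringChar 𝓀[(w.1.adicCompletion L)] ≠ 2 := by
    intro h
    haveI : CharP 𝓀[(w.1.adicCompletion L)] 2 := h ▸ ringChar.charP 𝓀[(w.1.adicCompletion L)]
    exact h2k (by simpa using (CharP.cast_eq_zero 𝓀[(w.1.adicCompletion L)] 2))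
  obtain ⟨ε, hε⟩ := FiniteField.exists_nonsquare hchar
  -- the strata rows of the conversion from the fold's rows
  have hR4 : ∀ (x : ((cmDatum L 3 H').Local v)) (z : Fin 3 → 𝓀[(w.1.adicCompletion L)]), (x ∈ cmLocalIntegralLevel L 3 H' v ∧
        (∀ a b, Valued.v (ϖ⁻¹ * ((((x).val : GL (Fin 3) (UnitaryGroup.LocalRing L v)).val.map (Pi.evalRingHom (fun w' : PlacesOver L v => w'.1.adicCompletion L) w)) a b - (1 : Matrix (Fin 3) (Fin 3) (w.1.adicCompletion L)) a b)) ≤ 1) ∧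
        (redMat (ϖ⁻¹ • ((((x).val : GL (Fin 3) (UnitaryGroup.LocalRing L v)).val.map (Pi.evalRingHom (fun w' : PlacesOver L v => w'.1.adicCompletion L) w)) - 1))) ^ 3 = 0 ∧ (redMat (ϖ⁻¹ • ((((x).val : GL (Fin 3) (UnitaryGroup.LocalRing L v)).val.map (Pi.evalRingHom (fun w' : PlacesOver L v => w'.1.adicCompletion L) w)) - 1))).rank = 1 ∧
        z ⬝ᵥ ((redMat (placeForm H' w.1) * redMat (ϖ⁻¹ • ((((x).val : GL (Fin 3) (UnitaryGroup.LocalRing L v)).val.map (Pi.evalRingHom (fun w' : PlacesOver L v => w'.1.adicCompletion L) w)) - 1))) *ᵥ z) ≠ 0) →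
        g x = (fun t : 𝓀[(w.1.adicCompletion L)] => if IsSquare t then c₁s else c₁n)
          (z ⬝ᵥ ((redMat (placeForm H' w.1) * redMat (ϖ⁻¹ • ((((x).val : GL (Fin 3) (UnitaryGroup.LocalRing L v)).val.map (Pi.evalRingHom (fun w' : PlacesOver L v => w'.1.adicCompletion L) w)) - 1))) *ᵥ z)) := by
    intro x z hx
    obtain ⟨h1, h2', h3, h4, h5⟩ := hx
    by_cases hs : IsSquare (z ⬝ᵥ ((redMat (placeForm H' w.1) * redMat (ϖ⁻¹ • ((((x).val : GL (Fin 3) (UnitaryGroup.LocalRing L v)).val.map (Pi.evalRingHom (fun w' : PlacesOver L v => w'.1.adicCompletion L) w)) - 1))) *ᵥ z))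
    · simp only [hs, if_true]
      exact hR4s x z ⟨h1, h2', h3, h4, h5, hs⟩
    · simp only [hs, if_false]
      exact hR4n x z ⟨h1, h2', h3, h4, h5, hs⟩
  have hR5 : ∀ t a : 𝓀[(w.1.adicCompletion L)], a ≠ 0 →
      (fun t : 𝓀[(w.1.adicCompletion L)] => if IsSquare t then c₁s else c₁n) (a ^ 2 * t) = (fun t : 𝓀[(w.1.adicCompletion L)] => if IsSquare t then c₁s else c₁n) t := by
    intro t a ha
    simp only [isSquare_sq_mul_iff_even₂ ha]
  have hΦp := classOrbitalIntegral_eq_mul_sixStrata_of_vDeep_ramified L H' νG hH' w hw he hH'w hH'i h2 ϖ hϖ hσϖ A hA hframe hmG tp hregp hdp g hg hgK hginv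
    (fun _ => c₂) c' (fun t : 𝓀[(w.1.adicCompletion L)] => if IsSquare t then c₁s else c₁n) ε hε hc hc'.1 hc'.2 hR4 hR5
  have hΦm := classOrbitalIntegral_eq_mul_sixStrata_of_vDeep_ramified L H' νG hH' w hw he hH'w hH'i h2 ϖ hϖ hσϖ A hA hframe hmG tm hregm hdm g hg hgK hginv
    (fun _ => c₂) c' (fun t : 𝓀[(w.1.adicCompletion L)] => if IsSquare t then c₁s else c₁n) ε hε hc hc'.1 hc'.2 hR4 hR5
  have hsq1 : IsSquare (1 : 𝓀[(w.1.adicCompletion L)]) := ⟨1, (mul_one 1).symm⟩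
  simp only [hsq1, if_true, hε, if_false] at hΦp hΦm
  rw [hΦp, hΦm]
  linear_combination (νG.real (cmLocalIntegralLevel L 3 H' v : Set ((cmDatum L 3 H').Local v)) : ℂ) * c₂ * hbd + (νG.real (cmLocalIntegralLevel L 3 H' v : Set ((cmDatum L 3 H').Local v)) : ℂ) * c' 2 * hrg + (νG.real (cmLocalIntegralLevel L 3 H' v : Set ((cmDatum L 3 H').Local v)) : ℂ) * c₁s * hsq + (νG.real (cmLocalIntegralLevel L 3 H' v : Set ((cmDatum L 3 H').Local v)) : ℂ) * c₁n * hns + (νG.real (cmLocalIntegralLevel L 3 H' v : Set ((cmDatum L 3 H').Local v)) : ℂ) * c' 0 * h0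

end Literature.NumberTheory.Rogawski1990

end
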